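import Literature.Topology.PlanarFoliations.FrameOrbitCycle
import Literature.Topology.PlanarFoliations.HugPolygon
import Literature.Topology.PlanarFoliations.TraceStraight
import HarnessLib

/-!
# Extraction of an essential simple polygon from the hugged walk of a hugging frame

Topic: Topology / PlanarFoliations, sequel to `FrameOrbitCycle.lean` (the periodic hugged walk of
a hugging frame as cycle data), `TraceStraight.lean` (a straight piece of the planar trace of the
built walk), `HugPolygon.lean` (loop erasure: an essential walk of pieces contains the walk of
pieces of a simple polygon with essential leaf loop). Given a hugging frame, an initial state
crossed on the side `s`, and — the part that depends on the hugger — the fact that **the base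
loop of the walk fence of every periodic part of the hugged walk is not null-homotopic** (`hnn`;
for the chain of compact leaves this is `HugDegree.walkBase_not_null`, for an accumulating open
leaf it is the no-spiral theorem), **there is a simple separatrix polygon with separatrices
through the hugged set `G` whose leaf loop is not null-homotopic** (`FData.exists_polyCycle`).

## References

* C. Camacho, A. Lins Neto, *Geometric Theory of Foliations*, Birkhäuser (1985), Ch. VII §2
  [CamachoLinsNeto1985].
-/

noncomputable section

open Set Filter Function Metric unitInterval
open _root_.Topology
open Literature.Topology.FourManifolds Literature.Topology.FourManifolds.Foliation

namespace Literature.Topology.PlanarFoliations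

variable {X : Type*} [TopologicalSpace X] [T2Space X] [SecondCountableTopology X] [Nonempty X] {F : Foliation ℝ X} {ι : X → ℂ}
variable {B : Type*} [NormedAddCommGroup B] [NormedSpace ℝ B] {M : Type*} [TopologicalSpace M] {T : Foliation B M} {g : ℂ → M}
variable {D : StarData F ι T g} {hbi : IsBiOriented F} {hι : IsOpenEmbedding ι} {C G : Set ℂ} {A : ℕ → X} {Fr : D.HugFrame hbi hι C G A}

namespace StarData

namespace FData

variable (ho : F.IsTransverselyOriented) {s : ℝ} (hs : s = 1 ∨ s = -1) (fd₀ : FData Fr) (hcross : fd₀.Cross s)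
  {C' : Set ℂ} (hC' : IsCompact C') (hsub : C ⊆ C')

include ho hs hcross in
/-- **Invariants along the hugged walk**: a property of points of the hugged set that passes to
the separatrices leaving the ω-saddle of a separatrix holds at every state, if it holds at the first one. [folklore] -/
theorem seq_invariant {Pinv : X → Prop} (h0 : Pinv fd₀.st.y)
    (hstep : ∀ y₁ (hy₁ : ι y₁ ∈ G) y₂ (hy₂ : ι y₂ ∈ G), Pinv y₁ →
      (haveI := (Fr.sep _ hy₂).1; alphaSet hbi ι y₂ = {Fr.vω hy₁}) → Pinv y₂) (k : ℕ) :
    Pinv (seq s fd₀ k).st.y := by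
  induction k with
  | zero => exact h0
  | succ k ih =>
    rw [seq_succ_eq_next ho fd₀ hs hcross k]
    exact hstep _ (seq s fd₀ k).st.hy _ ((seq s fd₀ k).next s _).st.hy ih ((seq s fd₀ k).alphaSet_next s _)

include ho hs hcross in
/-- **The hugged walk of a hugging frame yields an essential simple polygon with separatrices
through the hugged set**, once the base loops of the walk fences of its periodic parts are not
null-homotopic (for minimal periods: pairwise distinct darts); an invariant of the states
(`seq_invariant`) holds at its separatrices. [cite: CamachoLinsNeto1985, Ch. VII §2] -/
theorem exists_polyCycle {Pinv : X → Prop} (h0 : Pinv fd₀.st.y)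
    (hstep : ∀ y₁ (hy₁ : ι y₁ ∈ G) y₂ (hy₂ : ι y₂ ∈ G), Pinv y₁ →
      (haveI := (Fr.sep _ hy₂).1; alphaSet hbi ι y₂ = {Fr.vω hy₁}) → Pinv y₂)
    (hnn : ∀ (c p : ℕ) (_ : NeZero p) (hper : ∀ i, seq s fd₀ (c + i + p) = seq s fd₀ (c + i)),
      (∀ i j : ℕ, i < j → j < p → (seq s fd₀ (c + i)).dart ≠ (seq s fd₀ (c + j)).dart) →
      ¬ ∃ (q : T.LeafSpace) (L : Path q q), (∀ θ, L θ = toLeafSpace (D.walkBase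
        (D.walkJ hι hC' (cvtx_mem s fd₀ c p) (csx_mem s fd₀ c p hsub) (omega_csx s fd₀ c p) (alpha_csx ho hs hcross hper))
        (D.walkℓ hι hC' (cvtx_mem s fd₀ c p) (csx_mem s fd₀ c p hsub) (omega_csx s fd₀ c p) (alpha_csx ho hs hcross hper)) p θ)) ∧
        L.Homotopic (Path.refl q)) :
    ∃ Z : D.PolyCycle hbi C', (∀ i, ι (Z.sx i) ∈ G ∧ Pinv (Z.sx i)) ∧ ¬ (Z.leafLoop hι hC').Homotopic (Path.refl _) := by
  -- a minimal period of the hugged walk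
  obtain ⟨c, p, hp, hper, hdist⟩ := exists_min_period ho fd₀ hs hcross
  haveI : NeZero p := ⟨hp.ne'⟩
  -- the cycle data of the period and the built walk
  have hsx := csx_leaf_injective (s := s) (fd₀ := fd₀) (c := c) (p := p) hdist
  -- the composite of the walk of pieces is not homotopic to a constant path
  have hessW : ¬ ∃ R : Path (D.pos (D.walkJ hι hC' (cvtx_mem s fd₀ c p) (csx_mem s fd₀ c p hsub) (omega_csx s fd₀ c p)
      (alpha_csx ho hs hcross hper) 0).v) (D.pos (D.walkJ hι hC' (cvtx_mem s fd₀ c p) (csx_mem s fd₀ c p hsub)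
      (omega_csx s fd₀ c p) (alpha_csx ho hs hcross hper) p).v),
      (∀ θ, R θ = D.pos (cvtx s fd₀ c p (idx p 0))) ∧
        (D.polyWalk hι hC' (cvtx_mem s fd₀ c p) (csx_mem s fd₀ c p hsub) (omega_csx s fd₀ c p)
          (alpha_csx ho hs hcross hper) p).comp.Homotopic R := by
    rintro ⟨R, hR, h⟩
    exact hnn c p inferInstance hper hdist (D.exists_base_null_of_comp_polyWalk hι hC' _ _ _ _ R hR h)
  -- loop erasure: an essential simple polygon with separatrices among the `csx`
  obtain ⟨Z, hZsx, hZess⟩ := D.exists_polyCycle_of_not_null hι hC' (cvtx_mem s fd₀ c p) (csx_mem s fd₀ c p hsub)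
    (omega_csx s fd₀ c p) (alpha_csx ho hs hcross hper) hsx hessW
  refine ⟨Z, fun i ↦ ?_, hZess⟩
  obtain ⟨j, hj⟩ := hZsx i
  rw [hj]
  exact ⟨(seq s fd₀ (c + j)).st.hy, seq_invariant ho hs fd₀ hcross h0 hstep (c + j)⟩

end FData

end StarData

end Literature.Topology.PlanarFoliations
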